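import Literature.MathematicalPhysics.KineticTheory.LangevinChainGibbs
import Mathlib.MeasureTheory.Measure.Tilted
import Mathlib.MeasureTheory.Constructions.Pi
import Mathlib.MeasureTheory.Group.Measure
import Mathlib.MeasureTheory.Function.LocallyIntegrable
import HarnessLib

/-!
# The velocity-flip perturbation of an oscillator chain between Langevin baths (Bernardin–Olla)

Trunk T-KINETIC (Literature/MathematicalPhysics/KineticTheory); definition request
`defn-OscillatorChain.IsFlipSteadyState`, filed by the planner of route
`AtomisticToContinuum/FouriersLaw/NoiseHomotopyTransfer`, whose items
`stmt-AtomisticToContinuum-3112/3113/3114` inline the predicate defined here (that route was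
retired on 2026-08-15 under the D-0027 §2.1 audit, its file kept as record; the notion serves a
conforming successor and the sibling card `parity-split-noise-derivative`, which asks for the same
object `D_N(ε)`). Companion of `FouriersLaw.lean` (the chain `OscillatorChain`, its `generator`,
`bondCurrent`, `IsSteadyState`, `FouriersLawFor`) and `LangevinChainGibbs.lean` (the Gibbs measure
`gibbsMeasure`).

## The model (Bernardin–Olla 2011, §2.1)

Bernardin–Olla perturb the Hamiltonian dynamics of a chain of `n` oscillators between two
Langevin thermostats by "independent random flips of the sign of the velocities": the generator is
`L = A + γ S + γ_ℓ B_{1,T_ℓ} + γ_r B_{n,T_r}` with `A` the Liouville operator, `B_{j,T} =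
T ∂²_{p_j} - p_j ∂_{p_j}` the Langevin baths and the flip noise
`(S f)(ω) = ∑_x (f(ω^x) - f(ω))`, where `ω^x` is "the configuration obtained from `ω` by flipping
the momentum of particle `x`", `(p^x)_x = -p_x`, `(p^x)_z = p_z` for `z ≠ x` [BO2011, §2.1]. The
flip of one velocity conserves every kinetic energy `p_x²/2`, hence the energy, and carries no
energy current: the instantaneous bond currents are those of the deterministic chain [BO2011,
§2.1, `j_{x,x+1} = -p_x V'(r_{x+1})`]. At equal bath temperatures the Gibbs measure is invariant,
"`A` is antisymmetric in `L²(μ)` and `S`, `B_{j,T}` are symmetric" [BO2011, §2.1, after Prop. 1];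
a unique stationary state exists [BO2011, Prop. 1, §8]; for the harmonic chain with flips
Fourier's law holds in the stationary state, `lim n J_s = (4γ)⁻¹ (T_ℓ - T_r)` at zero tension
[BO2011, Thm 3].

## Contents

* `momentumFlip i : PhaseSpace N → PhaseSpace N`, `ω ↦ ω^i` (an involution, a measurable
  equivalence `momentumFlipEquiv i`, Lebesgue-measure preserving), and the flip generator
  `flipNoise N f x = ∑_i (f(ω^i) - f(ω))` (`S`, flips at EVERY site).
* `OscillatorChain.flipGenerator P N T_L T_R ε f = L f + ε S f` — the generator of
  `FouriersLaw.lean` (BLR Langevin baths at both ends) plus flips at rate `ε` at every site;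
  `OscillatorChain.IsFlipSteadyState P N T_L T_R ε μ` — weak steady states of `L + ε S`
  (probability measure, `∫ (L + εS) f dμ = 0` for `f ∈ C_c^∞`, bond currents integrable);
  `OscillatorChain.FlipFouriersLawFor P ε` — `FouriersLawFor` (BLR eq. (33), both clauses) with
  `IsSteadyState` replaced by `IsFlipSteadyState … ε`.
* API: `flipGenerator_zero`, `isFlipSteadyState_zero_iff`, `flipFouriersLawFor_zero_iff` (at
  `ε = 0` everything is the deterministic notion, by `simp`); `isFlipSteadyState_iff` (the
  inlined normal form of the route items, `Iff.rfl`); `flipGenerator_const`;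
  `integral_flipNoise_eq_zero`, `integral_mul_flipNoise` (`S` has mean zero and is symmetric for
  every flip-invariant measure); `isFlipSteadyState_iff_isSteadyState_of_flipInvariant` (for a
  flip-invariant `μ` the flip and deterministic steady-state conditions coincide, for every `ε`);
  `measurePreserving_momentumFlip_gibbsMeasure` (every Gibbs measure `volume.tilted (-H/T)` is
  flip-invariant) and hence `pinnedChain_isFlipSteadyState_gibbsMeasure`: at `T_L = T_R = T > 0`
  the Gibbs measure of the pinned anharmonic chain is a flip steady state for EVERY rate `ε`
  (non-vacuity of the definition), `isFlipSteadyState_zero_sites` (`N = 0`).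

## Design choices

* Flips at EVERY site `i : Fin N` at a common rate `ε` — the form inlined by the requesting route
  (`∫ (L f + ε ∑_i (f(q, p[i ↦ -p_i]) - f)) dμ = 0`); Bernardin–Olla's `S` sums over the interior
  sites `2 ≤ x ≤ n-1` only (the boundary momenta being already randomised by the baths) and
  their chain is unpinned, written in the distances `r_x`, with boundary tensions `τ_ℓ, τ_r`;
  here the deterministic part is the BLR pinned chain `OscillatorChain.generator` of
  `FouriersLaw.lean` in the coordinates `(q, p)`, as the route requires. No sign or positivity
  convention is imposed on `ε` in the definitions (the route uses `ε > 0`; `ε = 0` is the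
  deterministic chain: `isFlipSteadyState_zero_iff`).
* The bodies of `flipNoise`/`flipGenerator`/`IsFlipSteadyState`/`FlipFouriersLawFor` are kept
  syntactically identical to the inlined route terms (`f (x.1, Function.update x.2 i (-x.2 i))`),
  so that `P.IsFlipSteadyState N T_L T_R ε μ` unfolds to them by `Iff.rfl`
  (`isFlipSteadyState_iff`, `isFlipSteadyState_fun_eq`); `momentumFlip i x` is the same term,
  named, for the invariance API.
* Flip-invariance of a measure is expressed as `MeasurePreserving (momentumFlip i) μ μ`; the
  Gibbs measure of ANY `OscillatorChain` is flip-invariant because `H(ω^i) = H(ω)` and the flip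
  preserves Lebesgue measure (`measurePreserving_tilted_of_invariant`, a small abstract lemma on
  `Measure.tilted` proved here to keep imports minimal; cf. the analogous inlined lemmas in
  `Literature.Probability.LatticeModels.ONModelProofs`).
-/

noncomputable section

open MeasureTheory Filter Topology
open scoped ContDiff ENNReal

namespace Literature.MathematicalPhysics.KineticTheory.HeatConduction

variable {N : ℕ}

/-! ### The single-site momentum flip `ω ↦ ω^i` -/

/-- The configuration `ω^i` obtained from `ω = (q, p)` by flipping the momentum of particle `i`:
positions unchanged, `(p^i)_i = -p_i`, `(p^i)_z = p_z` for `z ≠ i`.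
[Bernardin–Olla 2011, §2.1 (definition of `ω^x`, `p^x`)] [cite: BernardinOlla2011, §2.1] -/
def momentumFlip (i : Fin N) (x : PhaseSpace N) : PhaseSpace N :=
  (x.1, Function.update x.2 i (-x.2 i))

/-- Unfolding `momentumFlip`. [folklore] -/
theorem momentumFlip_apply (i : Fin N) (x : PhaseSpace N) :
    momentumFlip i x = (x.1, Function.update x.2 i (-x.2 i)) := rfl

/-- The flip does not move the positions. [folklore] -/
@[simp] theorem momentumFlip_fst (i : Fin N) (x : PhaseSpace N) :
    (momentumFlip i x).1 = x.1 := rfl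

/-- The flipped momentum: `(p^i)_i = -p_i`. [folklore] -/
@[simp] theorem momentumFlip_snd_self (i : Fin N) (x : PhaseSpace N) :
    (momentumFlip i x).2 i = -x.2 i := by
  simp [momentumFlip]

/-- The other momenta are unchanged: `(p^i)_j = p_j` for `j ≠ i`. [folklore] -/
@[simp] theorem momentumFlip_snd_of_ne {i j : Fin N} (h : j ≠ i) (x : PhaseSpace N) :
    (momentumFlip i x).2 j = x.2 j := by
  simp [momentumFlip, h]

/-- Flipping the same momentum twice is the identity. [folklore] -/
@[simp] theorem momentumFlip_momentumFlip (i : Fin N) (x : PhaseSpace N) :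
    momentumFlip i (momentumFlip i x) = x := by
  refine Prod.ext rfl (funext fun j => ?_)
  by_cases h : j = i
  · subst h
    rw [momentumFlip_snd_self, momentumFlip_snd_self, neg_neg]
  · rw [momentumFlip_snd_of_ne h, momentumFlip_snd_of_ne h]

/-- `ω ↦ ω^i` is an involution. [folklore] -/
theorem momentumFlip_involutive (i : Fin N) : Function.Involutive (momentumFlip (N := N) i) :=
  momentumFlip_momentumFlip i

/-- `ω ↦ ω^i` is continuous. [folklore] -/
theorem continuous_momentumFlip (i : Fin N) : Continuous (momentumFlip (N := N) i) := by
  unfold momentumFlip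
  fun_prop

/-- `ω ↦ ω^i` is measurable. [folklore] -/
theorem measurable_momentumFlip (i : Fin N) : Measurable (momentumFlip (N := N) i) :=
  (continuous_momentumFlip i).measurable

/-- `ω ↦ ω^i` as a measurable equivalence of phase space (its own inverse). [folklore] -/
def momentumFlipEquiv (i : Fin N) : PhaseSpace N ≃ᵐ PhaseSpace N where
  toFun := momentumFlip i
  invFun := momentumFlip i
  left_inv := momentumFlip_momentumFlip i
  right_inv := momentumFlip_momentumFlip i
  measurable_toFun := measurable_momentumFlip i
  measurable_invFun := measurable_momentumFlip i

/-- The underlying map of `momentumFlipEquiv i` is `momentumFlip i`. [folklore] -/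
@[simp] theorem coe_momentumFlipEquiv (i : Fin N) :
    ⇑(momentumFlipEquiv (N := N) i) = momentumFlip i := rfl

/-- Negating one coordinate preserves Lebesgue measure on `ℝ^N`. [folklore] -/
theorem measurePreserving_update_neg (i : Fin N) :
    MeasurePreserving (fun p : Fin N → ℝ => Function.update p i (-p i))
      (volume : Measure (Fin N → ℝ)) volume := by
  have hf : ∀ j : Fin N, MeasurePreserving
      ((if j = i then (fun t : ℝ => -t) else id) : ℝ → ℝ) (volume : Measure ℝ) volume := by
    intro j
    split_ifs
    · exact Measure.measurePreserving_neg (volume : Measure ℝ)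
    · exact MeasurePreserving.id volume
  have h := volume_preserving_pi (α' := fun _ : Fin N => ℝ) (β' := fun _ : Fin N => ℝ) hf
  have hfun : (fun p : Fin N → ℝ => Function.update p i (-p i)) =
      fun (p : Fin N → ℝ) (j : Fin N) => (if j = i then (fun t : ℝ => -t) else id) (p j) := by
    funext p j
    by_cases hj : j = i
    · subst hj
      simp
    · simp [hj]
  rw [hfun]
  exact h

/-- `ω ↦ ω^i` preserves Lebesgue (Liouville) measure on phase space. [folklore] -/
theorem measurePreserving_momentumFlip_volume (i : Fin N) :
    MeasurePreserving (momentumFlip i) (volume : Measure (PhaseSpace N)) volume := by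
  have h : momentumFlip (N := N) i =
      Prod.map id (fun p : Fin N → ℝ => Function.update p i (-p i)) := by
    funext x
    rfl
  rw [h]
  exact (MeasurePreserving.id (volume : Measure (Fin N → ℝ))).prod (measurePreserving_update_neg i)

/-- The energy is invariant under each velocity flip: `H(ω^i) = H(ω)` (only `p_i²` enters).
[Bernardin–Olla 2011, §2.1] [folklore] -/
theorem OscillatorChain.hamiltonian_momentumFlip (P : OscillatorChain) (i : Fin N)
    (x : PhaseSpace N) : P.hamiltonian N (momentumFlip i x) = P.hamiltonian N x := by
  simp only [OscillatorChain.hamiltonian, momentumFlip]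
  congr 1
  refine Finset.sum_congr rfl fun j _ => ?_
  by_cases h : j = i
  · subst h
    simp only [Function.update_self]
    ring
  · simp only [Function.update_of_ne h]

/-! ### Flip-invariant measures -/

/-- Change of variables under a flip-invariant measure: `∫ f(ω^i) dμ = ∫ f dμ`. [folklore] -/
theorem integral_comp_momentumFlip {μ : Measure (PhaseSpace N)} {i : Fin N}
    (hμ : MeasurePreserving (momentumFlip i) μ μ) (f : PhaseSpace N → ℝ) :
    ∫ x, f (momentumFlip i x) ∂μ = ∫ x, f x ∂μ := by
  have h : MeasurePreserving (momentumFlipEquiv i) μ μ := hμ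
  exact h.integral_comp' (f := momentumFlipEquiv i) f

/-- Under a flip-invariant measure, `f ∘ (· ^i)` is integrable iff `f` is. [folklore] -/
theorem integrable_comp_momentumFlip_iff {μ : Measure (PhaseSpace N)} {i : Fin N}
    (hμ : MeasurePreserving (momentumFlip i) μ μ) {f : PhaseSpace N → ℝ} :
    Integrable (fun x => f (momentumFlip i x)) μ ↔ Integrable f μ :=
  hμ.integrable_comp_emb (momentumFlipEquiv i).measurableEmbedding

/-- Sitewise symmetry of the flip: `∫ g · (f ∘ ·^i) dμ = ∫ (g ∘ ·^i) · f dμ` for a flip-invariant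
`μ` (no integrability needed: both sides are the same Bochner integral after the change of
variables `ω ↦ ω^i`). [Bernardin–Olla 2011, §2.1 ("`S` … symmetric")] [folklore] -/
theorem integral_mul_comp_momentumFlip {μ : Measure (PhaseSpace N)} {i : Fin N}
    (hμ : MeasurePreserving (momentumFlip i) μ μ) (f g : PhaseSpace N → ℝ) :
    ∫ x, g x * f (momentumFlip i x) ∂μ = ∫ x, g (momentumFlip i x) * f x ∂μ := by
  rw [← integral_comp_momentumFlip hμ (fun x => g x * f (momentumFlip i x))]
  simp only [momentumFlip_momentumFlip]

/-- A measurable equivalence preserving `μ` and leaving the exponent `g` invariant preserves the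
exponentially tilted measure `μ.tilted g` (no measurability of `g` needed). [folklore] -/
theorem measurePreserving_tilted_of_invariant {α : Type*} [MeasurableSpace α] {μ : Measure α}
    (e : α ≃ᵐ α) (he : MeasurePreserving e μ μ) {g : α → ℝ} (hinv : ∀ x, g (e x) = g x) :
    MeasurePreserving e (μ.tilted g) (μ.tilted g) := by
  refine ⟨e.measurable, Measure.ext fun s hs => ?_⟩
  rw [Measure.map_apply e.measurable hs, tilted_apply' _ _ (e.measurable hs), tilted_apply' _ _ hs]
  calc ∫⁻ a in e ⁻¹' s, ENNReal.ofReal (Real.exp (g a) / ∫ x, Real.exp (g x) ∂μ) ∂μ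
      = ∫⁻ a in e ⁻¹' s, ENNReal.ofReal (Real.exp (g (e a)) / ∫ x, Real.exp (g x) ∂μ) ∂μ := by
        simp_rw [hinv]
    _ = ∫⁻ b in s, ENNReal.ofReal (Real.exp (g b) / ∫ x, Real.exp (g x) ∂μ) ∂μ :=
        he.setLIntegral_comp_preimage_emb e.measurableEmbedding
          (fun b => ENNReal.ofReal (Real.exp (g b) / ∫ x, Real.exp (g x) ∂μ)) s

/-- **Every Gibbs measure is flip-invariant**: for any chain `P`, any `N`, `T` and site `i`, the
flip `ω ↦ ω^i` preserves `gibbsMeasure P N T = Z⁻¹ e^{-H/T} dq dp` (the energy is even in each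
momentum and the flip preserves Liouville measure) — the mechanism behind "`S` is symmetric in
`L²` of the Gibbs measure". [Bernardin–Olla 2011, §2.1 (after Prop. 1)] [folklore] -/
theorem OscillatorChain.measurePreserving_momentumFlip_gibbsMeasure (P : OscillatorChain) (N : ℕ)
    (T : ℝ) (i : Fin N) :
    MeasurePreserving (momentumFlip i) (P.gibbsMeasure N T) (P.gibbsMeasure N T) :=
  measurePreserving_tilted_of_invariant (momentumFlipEquiv i)
    (measurePreserving_momentumFlip_volume i) fun x => by
      rw [coe_momentumFlipEquiv, P.hamiltonian_momentumFlip]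

/-! ### The flip noise `S` -/

/-- Bernardin–Olla's velocity-flip generator acting at every site:
`(S f)(ω) = ∑_i (f(ω^i) - f(ω))`, `ω^i = (q, p[i ↦ -p_i])` — independent rate-one Poisson flips
of the sign of each velocity. [Bernardin–Olla 2011, §2.1, eq. for `S` (there summed over the
interior sites `2 ≤ x ≤ n-1`)] [cite: BernardinOlla2011, §2.1] -/
def flipNoise (N : ℕ) (f : PhaseSpace N → ℝ) (x : PhaseSpace N) : ℝ :=
  ∑ i : Fin N, (f (x.1, Function.update x.2 i (-x.2 i)) - f x)

/-- `S f = ∑_i (f ∘ (·^i) - f)` in terms of `momentumFlip`. [folklore] -/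
theorem flipNoise_eq (N : ℕ) (f : PhaseSpace N → ℝ) (x : PhaseSpace N) :
    flipNoise N f x = ∑ i : Fin N, (f (momentumFlip i x) - f x) := rfl

/-- `S` kills constants. [folklore] -/
@[simp] theorem flipNoise_const (N : ℕ) (c : ℝ) (x : PhaseSpace N) :
    flipNoise N (fun _ => c) x = 0 := by
  simp [flipNoise]

/-- `S` kills the energy: `S H = 0` (each flip conserves `H`, `hamiltonian_momentumFlip`).
[Bernardin–Olla 2011, §2.1] [folklore] -/
@[simp] theorem flipNoise_hamiltonian (P : OscillatorChain) (N : ℕ) (x : PhaseSpace N) :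
    flipNoise N (P.hamiltonian N) x = 0 := by
  simp [flipNoise_eq, P.hamiltonian_momentumFlip]

/-- `S f` is integrable for a flip-invariant measure as soon as `f` is. [folklore] -/
theorem integrable_flipNoise {μ : Measure (PhaseSpace N)}
    (hμ : ∀ i, MeasurePreserving (momentumFlip i) μ μ) {f : PhaseSpace N → ℝ}
    (hf : Integrable f μ) : Integrable (flipNoise N f) μ := by
  have hfi : ∀ i, Integrable (fun x => f (momentumFlip i x)) μ := fun i =>
    (integrable_comp_momentumFlip_iff (hμ i)).2 hf
  show Integrable (fun x => ∑ i : Fin N, (f (momentumFlip i x) - f x)) μ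
  exact integrable_finsetSum _ fun i _ => (hfi i).sub' hf

/-- **`S` has mean zero under every flip-invariant measure**: `∫ S f dμ = 0` for integrable `f`
(each term `∫ (f(ω^i) - f(ω)) dμ` vanishes by the change of variables `ω ↦ ω^i`).
[Bernardin–Olla 2011, §2.1 (`S` symmetric for the Gibbs measure; `S 1 = 0`)] [folklore] -/
theorem integral_flipNoise_eq_zero {μ : Measure (PhaseSpace N)}
    (hμ : ∀ i, MeasurePreserving (momentumFlip i) μ μ) {f : PhaseSpace N → ℝ}
    (hf : Integrable f μ) : ∫ x, flipNoise N f x ∂μ = 0 := by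
  have hfi : ∀ i, Integrable (fun x => f (momentumFlip i x)) μ := fun i =>
    (integrable_comp_momentumFlip_iff (hμ i)).2 hf
  simp only [flipNoise_eq]
  rw [integral_finsetSum _ fun i _ => (hfi i).sub' hf]
  refine Finset.sum_eq_zero fun i _ => ?_
  rw [integral_sub (hfi i) hf, integral_comp_momentumFlip (hμ i), sub_self]

/-- **`S` is symmetric** in `L²` of every flip-invariant measure: `∫ g (S f) dμ = ∫ (S g) f dμ`
(given integrability of the products involved). [Bernardin–Olla 2011, §2.1 ("`S`, `B_{j,T}` …
are symmetric")] [cite: BernardinOlla2011, §2.1] -/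
theorem integral_mul_flipNoise {μ : Measure (PhaseSpace N)}
    (hμ : ∀ i, MeasurePreserving (momentumFlip i) μ μ) {f g : PhaseSpace N → ℝ}
    (hgf : Integrable (fun x => g x * f x) μ)
    (hi : ∀ i, Integrable (fun x => g x * f (momentumFlip i x)) μ) :
    ∫ x, g x * flipNoise N f x ∂μ = ∫ x, flipNoise N g x * f x ∂μ := by
  have hi' : ∀ i, Integrable (fun x => g (momentumFlip i x) * f x) μ := by
    intro i
    have h := (integrable_comp_momentumFlip_iff (hμ i)).2 (hi i)
    simpa only [momentumFlip_momentumFlip] using h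
  simp only [flipNoise_eq, Finset.mul_sum, Finset.sum_mul, mul_sub, sub_mul]
  rw [integral_finsetSum _ fun i _ => (hi i).sub' hgf,
    integral_finsetSum _ fun i _ => (hi' i).sub' hgf]
  refine Finset.sum_congr rfl fun i _ => ?_
  rw [integral_sub (hi i) hgf, integral_sub (hi' i) hgf, integral_mul_comp_momentumFlip (hμ i)]

namespace OscillatorChain

variable (P : OscillatorChain)

/-! ### The flip-noisy generator, its weak steady states, and Fourier's law with flips -/

/-- The generator `L_ε = L + ε S` of the `N`-site chain `P` between Langevin baths at `T_L, T_R`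
(`OscillatorChain.generator`, Bonetto–Lebowitz–Rey-Bellet 2000 eq. (10)) perturbed by independent
velocity flips `p_i ↦ -p_i` at rate `ε` at every site:
`L_ε f (q,p) = L f (q,p) + ε ∑_i (f(q, p[i ↦ -p_i]) - f(q,p))`.
[Bernardin–Olla 2011, §2.1 (`L = A + γS + γ_ℓ B_{1,T_ℓ} + γ_r B_{n,T_r}`, their `γ` is `ε` here,
their `S` flips interior sites only)] [cite: BernardinOlla2011, §2.1] -/
def flipGenerator (N : ℕ) (T_L T_R ε : ℝ) (f : PhaseSpace N → ℝ) (x : PhaseSpace N) : ℝ :=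
  P.generator N T_L T_R f x + ε * ∑ i : Fin N, (f (x.1, Function.update x.2 i (-x.2 i)) - f x)

/-- `P.IsFlipSteadyState N T_L T_R ε μ`: `μ` is a weak steady state of the flip-noisy chain —
a probability measure on phase space with `∫ (L f + ε S f) dμ = 0` for every smooth compactly
supported `f`, under which the bond energy currents `OscillatorChain.bondCurrent` (unchanged by the
flips, which conserve energy and carry no current) are integrable. At `ε = 0` this is
`OscillatorChain.IsSteadyState` verbatim (`isFlipSteadyState_zero_iff`).
[Bernardin–Olla 2011, §2.1 and Prop. 1 (the stationary state `μ_ss` of `L`)] [cite: BernardinOlla2011, §2.1 and Prop. 1] -/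
def IsFlipSteadyState (N : ℕ) (T_L T_R ε : ℝ) (μ : Measure (PhaseSpace N)) : Prop :=
  IsProbabilityMeasure μ ∧
    (∀ f : PhaseSpace N → ℝ, ContDiff ℝ ∞ f → HasCompactSupport f →
      ∫ x, P.flipGenerator N T_L T_R ε f x ∂μ = 0) ∧
    ∀ i : Fin N, Integrable (P.bondCurrent N i) μ

/-- **Fourier's law for the flip-noisy chain at rate `ε`**: `OscillatorChain.FouriersLawFor`
(Bonetto–Lebowitz–Rey-Bellet 2000, eq. (33), both clauses) with the steady states of `L` replaced
by those of `L + εS`: (i) for all `N` and `T_L, T_R > 0` the weak flip steady state exists and is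
unique; (ii) there is `κ_ε : ℝ → ℝ`, `κ_ε(T) > 0` for `T > 0`, such that for every family of flip
steady states and every `T > 0` the linear-response limits
`D_N = lim_{δ→0, δ≠0} totalCurrent(μ_{N,T+δ/2,T-δ/2})/δ` exist and `D_N → κ_ε(T)`. Printed only
for the harmonic chain (`lim n J_s = (4γ)⁻¹(T_ℓ - T_r)` at zero tension, Bernardin–Olla 2011
Thm 3; Bernardin–Olla 2005 for the exchange noise); for anharmonic chains with flips only the
Green–Kubo limit `lim_{λ→0} ⟪j, (λ - L)⁻¹ j⟫` is known to exist (Thm 2) — "we are not able to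
prove the same for `J_s` (i.e. Fourier's law). Only in the harmonic case …" (§1). A PREDICATE (the
chain and the rate are arguments), not a named fact.
[Bernardin–Olla 2011, Thm 3; Bonetto–Lebowitz–Rey-Bellet 2000, §5.3 eq. (33)] [cite: BernardinOlla2011, Thm 3] -/
def FlipFouriersLawFor (P : OscillatorChain) (ε : ℝ) : Prop :=
  (∀ (N : ℕ) (T_L T_R : ℝ), 0 < T_L → 0 < T_R →
      ∃ μ : Measure (PhaseSpace N), P.IsFlipSteadyState N T_L T_R ε μ ∧
        ∀ ν : Measure (PhaseSpace N), P.IsFlipSteadyState N T_L T_R ε ν → ν = μ) ∧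
  ∃ κ : ℝ → ℝ, (∀ T, 0 < T → 0 < κ T) ∧
    ∀ μ : (N : ℕ) → ℝ → ℝ → Measure (PhaseSpace N),
      (∀ (N : ℕ) (T_L T_R : ℝ), 0 < T_L → 0 < T_R →
        P.IsFlipSteadyState N T_L T_R ε (μ N T_L T_R)) →
      ∀ T : ℝ, 0 < T →
        ∃ D : ℕ → ℝ,
          (∀ N : ℕ, Tendsto (fun δ : ℝ => P.totalCurrent (μ N (T + δ / 2) (T - δ / 2)) / δ)
            (𝓝[≠] 0) (𝓝 (D N))) ∧
          Tendsto D atTop (𝓝 (κ T))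

/-! ### API -/

/-- `L_ε f = L f + ε S f`. [Bernardin–Olla 2011, §2.1] [folklore] -/
theorem flipGenerator_eq_add_flipNoise (N : ℕ) (T_L T_R ε : ℝ) (f : PhaseSpace N → ℝ)
    (x : PhaseSpace N) :
    P.flipGenerator N T_L T_R ε f x = P.generator N T_L T_R f x + ε * flipNoise N f x := rfl

/-- `L_ε f` written with `momentumFlip`. [folklore] -/
theorem flipGenerator_apply (N : ℕ) (T_L T_R ε : ℝ) (f : PhaseSpace N → ℝ) (x : PhaseSpace N) :
    P.flipGenerator N T_L T_R ε f x =
      P.generator N T_L T_R f x + ε * ∑ i : Fin N, (f (momentumFlip i x) - f x) := rfl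

/-- At rate `ε = 0` the flip-noisy generator is the deterministic one. [folklore] -/
@[simp] theorem flipGenerator_zero (N : ℕ) (T_L T_R : ℝ) :
    P.flipGenerator N T_L T_R 0 = P.generator N T_L T_R := by
  funext f x
  simp [flipGenerator]

/-- `L_ε` annihilates constants (`L 1 = 0`, `S 1 = 0`: conservation of probability). [folklore] -/
@[simp] theorem flipGenerator_const (N : ℕ) (T_L T_R ε c : ℝ) (x : PhaseSpace N) :
    P.flipGenerator N T_L T_R ε (fun _ => c) x = 0 := by
  simp [flipGenerator]

/-- `L_ε` is affine in the rate: `L_ε f = L_0 f + ε S f` with `L_{ε+ε'} f = L_ε f + ε' S f`.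
[folklore] -/
theorem flipGenerator_add_rate (N : ℕ) (T_L T_R ε ε' : ℝ) (f : PhaseSpace N → ℝ)
    (x : PhaseSpace N) :
    P.flipGenerator N T_L T_R (ε + ε') f x = P.flipGenerator N T_L T_R ε f x + ε' * flipNoise N f x := by
  simp only [flipGenerator_eq_add_flipNoise]
  ring

/-- Unfolding `IsFlipSteadyState` into the normal form inlined by the route items of
`NoiseHomotopyTransfer` (bound there as `S ε N T_L T_R μ`). [folklore] -/
theorem isFlipSteadyState_iff (N : ℕ) (T_L T_R ε : ℝ) (μ : Measure (PhaseSpace N)) :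
    P.IsFlipSteadyState N T_L T_R ε μ ↔
      IsProbabilityMeasure μ ∧
        (∀ f : PhaseSpace N → ℝ, ContDiff ℝ ∞ f → HasCompactSupport f →
          ∫ x, (P.generator N T_L T_R f x +
            ε * ∑ i : Fin N, (f (x.1, Function.update x.2 i (-x.2 i)) - f x)) ∂μ = 0) ∧
        ∀ i : Fin N, Integrable (P.bondCurrent N i) μ :=
  Iff.rfl

/-- The inlined steady-state family of the route items (`fun ε N T_L T_R μ => …`) IS
`fun ε N T_L T_R μ => P.IsFlipSteadyState N T_L T_R ε μ`, definitionally. [folklore] -/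
theorem isFlipSteadyState_fun_eq :
    (fun (ε : ℝ) (N : ℕ) (T_L T_R : ℝ) (μ : Measure (PhaseSpace N)) =>
        IsProbabilityMeasure μ ∧
          (∀ f : PhaseSpace N → ℝ, ContDiff ℝ ∞ f → HasCompactSupport f →
            ∫ x, (P.generator N T_L T_R f x +
              ε * ∑ i : Fin N, (f (x.1, Function.update x.2 i (-x.2 i)) - f x)) ∂μ = 0) ∧
          ∀ i : Fin N, Integrable (P.bondCurrent N i) μ) =
      fun ε N T_L T_R μ => P.IsFlipSteadyState N T_L T_R ε μ :=
  rfl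

/-- **At `ε = 0` a flip steady state is a steady state of the deterministic chain and
conversely.** [folklore] -/
@[simp] theorem isFlipSteadyState_zero_iff (N : ℕ) (T_L T_R : ℝ) (μ : Measure (PhaseSpace N)) :
    P.IsFlipSteadyState N T_L T_R 0 μ ↔ P.IsSteadyState N T_L T_R μ := by
  simp only [IsFlipSteadyState, IsSteadyState, flipGenerator_zero]

/-- **At `ε = 0`, Fourier's law with flips is Fourier's law** (`FouriersLawFor`). [folklore] -/
theorem flipFouriersLawFor_zero_iff : P.FlipFouriersLawFor 0 ↔ P.FouriersLawFor := by
  simp only [FlipFouriersLawFor, FouriersLawFor, isFlipSteadyState_zero_iff]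

/-- Unfolding `FlipFouriersLawFor`. [folklore] -/
theorem flipFouriersLawFor_iff (ε : ℝ) :
    P.FlipFouriersLawFor ε ↔
      (∀ (N : ℕ) (T_L T_R : ℝ), 0 < T_L → 0 < T_R →
          ∃ μ : Measure (PhaseSpace N), P.IsFlipSteadyState N T_L T_R ε μ ∧
            ∀ ν : Measure (PhaseSpace N), P.IsFlipSteadyState N T_L T_R ε ν → ν = μ) ∧
      ∃ κ : ℝ → ℝ, (∀ T, 0 < T → 0 < κ T) ∧
        ∀ μ : (N : ℕ) → ℝ → ℝ → Measure (PhaseSpace N),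
          (∀ (N : ℕ) (T_L T_R : ℝ), 0 < T_L → 0 < T_R →
            P.IsFlipSteadyState N T_L T_R ε (μ N T_L T_R)) →
          ∀ T : ℝ, 0 < T →
            ∃ D : ℕ → ℝ,
              (∀ N : ℕ, Tendsto (fun δ : ℝ => P.totalCurrent (μ N (T + δ / 2) (T - δ / 2)) / δ)
                (𝓝[≠] 0) (𝓝 (D N))) ∧
              Tendsto D atTop (𝓝 (κ T)) :=
  Iff.rfl

variable {P}

/-- A flip steady state is a probability measure. [folklore] -/
theorem IsFlipSteadyState.isProbabilityMeasure {N : ℕ} {T_L T_R ε : ℝ}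
    {μ : Measure (PhaseSpace N)} (h : P.IsFlipSteadyState N T_L T_R ε μ) :
    IsProbabilityMeasure μ :=
  h.1

/-- The weak stationarity equation `∫ L_ε f dμ = 0` of a flip steady state. [folklore] -/
theorem IsFlipSteadyState.integral_flipGenerator {N : ℕ} {T_L T_R ε : ℝ}
    {μ : Measure (PhaseSpace N)} (h : P.IsFlipSteadyState N T_L T_R ε μ)
    {f : PhaseSpace N → ℝ} (hf : ContDiff ℝ ∞ f) (hfc : HasCompactSupport f) :
    ∫ x, P.flipGenerator N T_L T_R ε f x ∂μ = 0 :=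
  h.2.1 f hf hfc

/-- The bond currents are integrable under a flip steady state. [folklore] -/
theorem IsFlipSteadyState.integrable_bondCurrent {N : ℕ} {T_L T_R ε : ℝ}
    {μ : Measure (PhaseSpace N)} (h : P.IsFlipSteadyState N T_L T_R ε μ) (i : Fin N) :
    Integrable (P.bondCurrent N i) μ :=
  h.2.2 i

variable (P)

/-- **The flip part drops out of the stationarity equation for flip-invariant measures**: if every
`ω ↦ ω^i` preserves `μ` and `f` is `μ`-integrable then `∫ L_ε f dμ = ∫ L f dμ` for every `ε`
(whether or not `L f` is integrable: `ε S f` is integrable with integral zero).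
[Bernardin–Olla 2011, §2.1] [folklore] -/
theorem integral_flipGenerator_eq_of_flipInvariant {N : ℕ} {μ : Measure (PhaseSpace N)}
    (hμ : ∀ i, MeasurePreserving (momentumFlip i) μ μ) (T_L T_R ε : ℝ) {f : PhaseSpace N → ℝ}
    (hf : Integrable f μ) :
    ∫ x, P.flipGenerator N T_L T_R ε f x ∂μ = ∫ x, P.generator N T_L T_R f x ∂μ := by
  have hS : Integrable (fun x => ε * flipNoise N f x) μ := (integrable_flipNoise hμ hf).const_mul ε
  have hS0 : ∫ x, ε * flipNoise N f x ∂μ = 0 := by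
    rw [integral_const_mul, integral_flipNoise_eq_zero hμ hf, mul_zero]
  simp only [flipGenerator_eq_add_flipNoise]
  by_cases hg : Integrable (fun x => P.generator N T_L T_R f x) μ
  · rw [integral_add hg hS, hS0, add_zero]
  · have hgh : ¬ Integrable (fun x => P.generator N T_L T_R f x + ε * flipNoise N f x) μ := by
      rwa [integrable_add_iff_integrable_left' hS]
    rw [integral_undef hg, integral_undef hgh]

/-- **For a flip-invariant measure the flip and the deterministic steady-state conditions
coincide, at every rate `ε`** (e.g. any measure with a density even in each momentum
separately). [Bernardin–Olla 2011, §2.1] [folklore] -/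
theorem isFlipSteadyState_iff_isSteadyState_of_flipInvariant {N : ℕ} {μ : Measure (PhaseSpace N)}
    (hμ : ∀ i, MeasurePreserving (momentumFlip i) μ μ) (T_L T_R ε : ℝ) :
    P.IsFlipSteadyState N T_L T_R ε μ ↔ P.IsSteadyState N T_L T_R μ := by
  refine and_congr_right fun hprob => and_congr_left' (forall_congr' fun f =>
    forall_congr' fun hf => forall_congr' fun hfc => ?_)
  rw [P.integral_flipGenerator_eq_of_flipInvariant hμ T_L T_R ε
    (hf.continuous.integrable_of_hasCompactSupport hfc)]

/-- The empty chain: the point mass is a flip steady state for all parameters (`N = 0`).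
[folklore] -/
theorem isFlipSteadyState_zero_sites (T_L T_R ε : ℝ) :
    P.IsFlipSteadyState 0 T_L T_R ε (Measure.dirac default) :=
  (P.isFlipSteadyState_iff_isSteadyState_of_flipInvariant (fun i => i.elim0) T_L T_R ε).2
    (P.isSteadyState_zero T_L T_R)

end OscillatorChain

/-! ### Equilibrium: the Gibbs measure is a flip steady state for every rate -/

section Pinned

variable {ω₂ lam β : ℝ}

/-- **Equilibrium flip steady state (all `N`, every rate).** For the pinned anharmonic chain
`pinnedChain ω₂ lam β γ` (`ω₂ > 0`, `lam, β ≥ 0`, any `γ`) at equal bath temperatures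
`T_L = T_R = T > 0`, the Gibbs measure `Z⁻¹ e^{-H/T} dq dp` is a weak steady state of `L + εS` for
EVERY flip rate `ε`: it is a steady state of `L` (`pinnedChain_isSteadyState_gibbsMeasure`,
Cuneo–Eckmann–Hairer–Rey-Bellet 2018 §3.1) and flip-invariant
(`measurePreserving_momentumFlip_gibbsMeasure`). In particular the predicate `IsFlipSteadyState`
is inhabited. [Bernardin–Olla 2011, §2.1 ("the Gibbs measure … is invariant for `L_eq`"; "`S` …
symmetric")] [cite: BernardinOlla2011, §2.1] -/
theorem pinnedChain_isFlipSteadyState_gibbsMeasure (hω : 0 < ω₂) (hl : 0 ≤ lam) (hβ : 0 ≤ β)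
    (γ : ℝ) (N : ℕ) {T : ℝ} (hT : 0 < T) (ε : ℝ) :
    (pinnedChain ω₂ lam β γ).IsFlipSteadyState N T T ε ((pinnedChain ω₂ lam β γ).gibbsMeasure N T) :=
  ((pinnedChain ω₂ lam β γ).isFlipSteadyState_iff_isSteadyState_of_flipInvariant
      (fun i => (pinnedChain ω₂ lam β γ).measurePreserving_momentumFlip_gibbsMeasure N T i)
      T T ε).2
    (pinnedChain_isSteadyState_gibbsMeasure hω hl hβ γ N hT)

/-- **One site, arbitrary temperatures, every rate.** For `N = 1` both baths act on `p_0`; the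
Gibbs measure at the mean temperature `(T_L + T_R)/2` is a flip steady state for every `ε`.
[folklore] -/
theorem pinnedChain_isFlipSteadyState_gibbsMeasure_one (hω : 0 < ω₂) (hl : 0 ≤ lam) (hβ : 0 ≤ β)
    (γ : ℝ) {T_L T_R : ℝ} (hL : 0 < T_L) (hR : 0 < T_R) (ε : ℝ) :
    (pinnedChain ω₂ lam β γ).IsFlipSteadyState 1 T_L T_R ε
      ((pinnedChain ω₂ lam β γ).gibbsMeasure 1 ((T_L + T_R) / 2)) :=
  ((pinnedChain ω₂ lam β γ).isFlipSteadyState_iff_isSteadyState_of_flipInvariant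
      (fun i => (pinnedChain ω₂ lam β γ).measurePreserving_momentumFlip_gibbsMeasure 1 _ i)
      T_L T_R ε).2
    (pinnedChain_isSteadyState_gibbsMeasure_one hω hl hβ γ hL hR)

end Pinned

end Literature.MathematicalPhysics.KineticTheory.HeatConduction
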